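import Mathlib
import Literature.MathematicalPhysics.MHD.HainLustSigmaStability
import Literature.Analysis.ValidatedNumerics.PolySignCells
import Summits.Ventures.FusionMHD.Models.KinkEqScrewPinchQ07
import Summits.Ventures.FusionMHD.Models.KinkEqScrewPinchQ07Witness
import Summits.Ventures.FusionMHD.Models.KinkEqQ07Sigma013WitnessBlocks
import Summits.Ventures.FusionMHD.Models.KinkEqQ07Sigma013WitnessW1
import Summits.Ventures.FusionMHD.Models.KinkEqQ07Sigma013WitnessW2
import HarnessLib

/-!
# F3.σ rider of #95 («#95‴ LOWER-013»): a certified σ-INSTABILITY WITNESS — the `(1,1)` internal kink of MODEL M_kink (`q₀ = 7/10` force-balanced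
# screw pinch) has `W + σ²I < 0` at `σ = 13/1000` for an explicit displacement (kernel; HainLustSigmaStability §10)

LADDER-GRIDFUSION rung F3, the LOWER-BOUND side of the F3.σ apex (lead g6 RULINGS 7f/7i/7i′: row #95 «F3.σ-KINK-UNSTABLE», typist
`gridfusion-sos-6` g5, 2026-08-27; generator `HOME/cert/sos-6/kink/{derive2.py, majorant.py, emit_witness.py}`, companions `Models/KinkEqQ07Sigma013Witness{Data,Blocks}.lean`, cert
`HOME/cert/F/kink-q07-R5-s013-witness-cert.json`).  MODEL M_kink = lit-4's `KinkEqQ07.hlK` (`Models/KinkEqScrewPinchQ07.lean`, p532517: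
`u = 2/(7(1+r²))`, `B_θ = r u`, `B_z ≡ 1`, FORCE-BALANCED pressure `pK = 2/(49(1+r²)²) − 1/98 + 1/4900`, `ρ ≡ 1`, `γ = 5/3`, `μ₀ = 1`,
`q = (7/10)(1 + r²)` so `q = 1` INSIDE the plasma at `r² = 3/7` (`resonanceK`), `R₀ = 5a`, wall AT the plasma `a = 1`) — `hlK`, `uK`, `pK`,
`pK_pos`, `bsq_posK`, `kineticNorm_nonnegK` IMPORTED BY NAME, nothing restated.  The TRIAL FUNCTION is sos-6 g5's OWN (the
12-term minimiser of the 𝓡-quadratic form at σ = 13/1000, float inverse iteration, coefficients rounded to the common denominator 10⁵;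
HOME/cert/sos-6/kink/kink_own_a_013.json): `ξ(r) = (1 − r²)·Σ_{i=0}^{11} aᵢTᵢ(2r² − 1)` with
`a = (89009/100000, −1, 243/20000, 33427/100000, −983/12500, −11719/100000, 421/5000, 4227/100000, −423/12500, −167/20000, 1609/50000, −41/50000)` (`xiK_eq_cheb013` displays
these literals; `xiK013` itself is the expanded even polynomial of degree 24), `η_*, ζ_*` the algebraic minimisers of §10
(`hlK.etaStarOf/zetaStarOf 1 (−1/5) (1/100) xiK013`).

THE MATHEMATICS (HainLustSigmaStability v8 §10, lit-4 p530956: `sigmaModifiedEnergy_star_neg_of_integral_neg` — for `(ξ, η_*, ζ_*)`,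
`W^σ = ∫₀¹ 𝓡_ξ dr` with `𝓡_ξ = A(ξ + rξ′)² + 2(τ − Br)(rξ)(ξ + rξ′) + C₀(rξ)² + τ′(rξ)²` at `ω² = −σ²`; `∫ < 0 ⇒ W^σ < 0`).
(1) CLOSED FORMS of the model blocks at `(m, k) = (1, −1/5)`, `ω² = −(13/1000)²`: with `H(r) = hlDnum013` (degree 10, `> 0` on `[0, 1]`),
`D = H/(7203000000000000·r²(1+r²)⁴)`, `A = −r·A_N/(980(1+r²)²H)`, `Br = −4B_N/(49(1+r²)²H)`, `C₀ = −C_N/(49000000·r(1+r²)²H)`,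
`τ = −8(5 + 18r²)/(49(1+r²)²(25+r²))`, `τ′ = 48r(−65 + 155r² + 12r⁴)/(49(1+r²)³(25+r²)²)` (`field_simp; ring` each); hence
`𝓡_ξ = R_N(r)/(H(r)(1+r²)³(25+r²)²)` on `(0, 1]` with `R_N` of degree 69 (`reducedDensity_eqK013`).  (2) MAJORANT: a degree-40 polynomial `U`
(Chebyshev interpolant of `𝓡_ξ` + 7/1000000, dyadic coefficients) with `U·H(1+r²)³(25+r²)² − R_N > 0` on `[0, 1]` (`WK_posCells`, 7 dyadic
cells, `decide +kernel`) ⇒ `𝓡_ξ ≤ U` on `(0, 1]`; `∫₀¹ U = -1.0508e-05 ≈ −5.20·10⁻⁵ < 0` EXACTLY (antiderivative `Poly.ad`, `decide +kernel` on ℚ);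
so `∫₀¹ 𝓡_ξ ≤ ∫₀¹ U < 0` (own float Gauss–Legendre value of the integral itself: −1.751·10⁻⁵; lit-4's independent exact-data witnesses at σ = 13/1000 with ITS 16/20-term ξ: −2.60/−2.77·10⁻⁵, j280714).
(3) INTEGRABILITY of the two densities of `(ξ, η_*, ζ_*)` on `[0, 1]`: `η_*² = E_N²/(B²H²(1+r²)²)`, `ζ_*² = Z_N²/(B²H²(1+r²)²)` (the axis
factors `1/r²` of (9.29) cancel EXACTLY against `k₀² = 1/r² + k²` in `D`), so the norm density equals a function continuous on `[0, 1]` off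
`r = 0`, and the energy density is `𝓡_ξ − σ²·(norm density)` on `(0, 1]` (`density_star_eq_reduced`).

CERTIFIED (kernel): `kink_sigma_unstable013` — `hlK.sigmaModifiedEnergy 1 (−1/5) (1/100) 1 ξ η_* ζ_* < 0`: MODEL M_kink is NOT σ-stable at
`σ = 13/1000`; `kink_not_sigmaStable013` (no §5–§9 certificate can exist at `σ = 13/1000`); `kink_potentialEnergy_neg013` (`W < 0`: the ideal energy
principle is VIOLATED by this displacement); the witness is in CLASS C of ★ #66/#72 (`xiK_contDiff013`, `xiK_one013`, `xiK_ne013`).  In the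
MODELLED spectral reading of (6.117) [GoedbloedPoedts2004 §6.5.3, §9.4.1 Theorem p. 470]: an ideal internal-kink perturbation of M_kink
growing at least at `0.013 v_A/a` — an energy-principle WITNESS, not an eigenmode; lit-4's «#95′ BRACKET» (§9 certificate at `σ = 3/100`)
is the other side.  THREE COLUMNS: CERTIFIED the inequality for MODEL M_kink and this displacement | VALIDATED lit-4 kits j278652/j278719
(float bracket, 50-digit quadrature), sos-2 kink_witness_B.py | MODELLED straight periodic cylinder, ideal MHD, Hain–Lüst single-helicity
reduction, wall at `r = a`, force-balanced ANALYTIC profile CHOSEN to have `q = 1` inside (SYNTHETIC `q₀ = 7/10`; the `q₀ > 1` control has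
no witness, consistent with ★ #72).  NEVER «the plasma is unstable» without MODEL M_kink and CLASS; not about any device.  No
`native_decide`, no `sorry`; axioms standard.  [instance data]
-/

noncomputable section

open Set Polynomial MeasureTheory Literature.MathematicalPhysics.MHD
open Literature.Analysis.ValidatedNumerics Literature.Analysis.ValidatedNumerics.ExpPoly

namespace Summit.Ventures.FusionMHD.Models.KinkEqQ07

/-! ### §3 The reduced density `𝓡_ξ = R_N/(H(1+r²)³(25+r²)²)` on `(0, 1]` and its polynomial majorant -/

set_option maxRecDepth 20000 in
/-- **`𝓡_ξ(r) = R_N(r)/(H(r)(1+r²)³(25+r²)²)` for `0 < r ≤ 1`.** [instance data] -/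
theorem reducedDensity_eqK013 {r : ℝ} (hr : 0 < r) (hr1 : r ≤ 1) :
    hlK.reducedDensity 1 (-1 / 5) (13 / 1000) xiK013 r = Poly.eval RNL013 r / (hlDnum013 r * (1 + r ^ 2) ^ 3 * (25 + r ^ 2) ^ 2) := by
  have hr0 : r ≠ 0 := hr.ne'
  have h1 : (1 : ℝ) + r ^ 2 ≠ 0 := by positivity
  have h25 : (25 : ℝ) + r ^ 2 ≠ 0 := by positivity
  have hH : hlDnum013 r ≠ 0 := (hlDnum_pos013 hr.le hr1).ne'
  simp only [ScrewPinch.DynProfile.reducedDensity]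
  rw [hlA_eqK013 hr hr1, hlBr_eqK013 hr hr1, hlC0_eqK013 hr hr1, margTau_eqK hr0, deriv_margTau_eqK hr0, deriv_xiK013]
  simp only [xiK013]
  rw [XIP_eval013, dXIP_eval013]
  field_simp
  simp only [hlDnum013, RNL013, Poly.eval_cons, Poly.eval_nil]
  push_cast
  ring

/-- `W > 0` on `[0, 1]` (the two half-certificates `WL_posCellsA/B`). [instance data] -/
theorem WL_pos013 {r : ℝ} (h0 : 0 ≤ r) (h1 : r ≤ 1) : 0 < Poly.eval WL013 r := by
  rcases le_or_gt r (1 / 2 : ℝ) with h | h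
  · exact Poly.pos_of_posCells WL_posCellsA013 (x := r) (by exact_mod_cast h0) (by push_cast; linarith)
  · exact Poly.pos_of_posCells WL_posCellsB013 (x := r) (by push_cast; linarith) (by exact_mod_cast h1)

/-- **`𝓡_ξ ≤ U` on `(0, 1]`.** [instance data] -/
theorem reducedDensity_le_U013 {r : ℝ} (hr : 0 < r) (hr1 : r ≤ 1) :
    hlK.reducedDensity 1 (-1 / 5) (13 / 1000) xiK013 r ≤ Poly.eval UL013 r := by
  have hW := WL_pos013 hr.le hr1
  rw [WL_eval013] at hW
  have hden : 0 < hlDnum013 r * (1 + r ^ 2) ^ 3 * (25 + r ^ 2) ^ 2 := by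
    have := hlDnum_pos013 hr.le hr1; positivity
  rw [reducedDensity_eqK013 hr hr1, div_le_iff₀ hden]
  nlinarith

/-- `∫₀¹ U = U⁽⁻¹⁾(1) − U⁽⁻¹⁾(0)` with the exact antiderivative `Poly.ad 0 U`. [instance data] -/
theorem integral_UL013 : ∫ r in (0 : ℝ)..1, Poly.eval UL013 r = Poly.eval (Poly.ad 0 UL013) 1 - Poly.eval (Poly.ad 0 UL013) 0 :=
  intervalIntegral.integral_eq_sub_of_hasDerivAt (fun x _ => PolyMP.hasDerivAt_eval_ad_zero UL013 x)
    ((Poly.continuous_eval UL013).intervalIntegrable _ _)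

/-- `∫₀¹ U < 0` (`= -1.0508e-05`, exact). [instance data] -/
theorem integral_UL_neg013 : ∫ r in (0 : ℝ)..1, Poly.eval UL013 r < 0 := by
  rw [integral_UL013]
  have e1 := Poly.eval_evalQ (Poly.ad 0 UL013) 1
  have e0 := Poly.eval_evalQ (Poly.ad 0 UL013) 0
  push_cast at e1 e0
  rw [← e1, ← e0]
  have hq : Poly.evalQ (Poly.ad 0 UL013) 1 - Poly.evalQ (Poly.ad 0 UL013) 0 < 0 := by decide +kernel
  exact_mod_cast hq

/-! ### §4 Integrability of the densities of `(ξ, η_*, ζ_*)` on `[0, 1]` -/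

set_option maxRecDepth 20000 in
/-- `η_*² = E_N²/(B²·(H(1+r²))²)` on `(0, 1]` (the `1/r²` of (9.29) cancels against `k₀² = 1/r² + k²` in `D`). [instance data] -/
theorem etaStar_sqK013 {r : ℝ} (hr : 0 < r) (hr1 : r ≤ 1) :
    hlK.etaStarOf 1 (-1 / 5) (13 / 1000) xiK013 r ^ 2 = Poly.eval ENL013 r ^ 2 / (hlK.Bsq r * (hlDnum013 r * (1 + r ^ 2)) ^ 2) := by
  have hr0 : r ≠ 0 := hr.ne'
  have h1 : (1 : ℝ) + r ^ 2 ≠ 0 := by positivity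
  have hH : hlDnum013 r ≠ 0 := (hlDnum_pos013 hr.le hr1).ne'
  have hB := bsq_posK r
  have hs : Real.sqrt (hlK.Bsq r) ^ 2 = hlK.Bsq r := Real.sq_sqrt hB.le
  simp only [ScrewPinch.DynProfile.etaStarOf, ScrewPinch.DynProfile.etaStar]
  rw [div_pow _ (r ^ 2 * Real.sqrt (hlK.Bsq r) * hlK.hlDGP 1 (-1 / 5) (-(13 / 1000) ^ 2) r),
    mul_pow (r ^ 2 * Real.sqrt (hlK.Bsq r)) (hlK.hlDGP 1 (-1 / 5) (-(13 / 1000) ^ 2) r),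
    mul_pow (r ^ 2) (Real.sqrt (hlK.Bsq r)), hs, hlDGP_eqK013 hr0, deriv_xiK013]
  simp only [ScrewPinch.DynProfile.hlS, ScrewPinch.DynProfile.hlI, ScrewPinch.DynProfile.kPerpB, ScrewPinch.Profile.kDotB,
    bsq_eqK, xiK013, XIP_eval013, dXIP_eval013]
  simp only [hlK, uK, pK]
  have h2 : (49 : ℝ) + 102 * r ^ 2 + 49 * r ^ 4 ≠ 0 := by positivity
  field_simp
  simp only [ENL013, Poly.eval_cons, Poly.eval_nil]
  push_cast
  ring

set_option maxRecDepth 20000 in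
/-- `ζ_*² = Z_N²/(B²·(H(1+r²))²)` on `(0, 1]`. [instance data] -/
theorem zetaStar_sqK013 {r : ℝ} (hr : 0 < r) (hr1 : r ≤ 1) :
    hlK.zetaStarOf 1 (-1 / 5) (13 / 1000) xiK013 r ^ 2 = Poly.eval ZNL013 r ^ 2 / (hlK.Bsq r * (hlDnum013 r * (1 + r ^ 2)) ^ 2) := by
  have hr0 : r ≠ 0 := hr.ne'
  have h1 : (1 : ℝ) + r ^ 2 ≠ 0 := by positivity
  have hH : hlDnum013 r ≠ 0 := (hlDnum_pos013 hr.le hr1).ne'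
  have hB := bsq_posK r
  have hs : Real.sqrt (hlK.Bsq r) ^ 2 = hlK.Bsq r := Real.sq_sqrt hB.le
  simp only [ScrewPinch.DynProfile.zetaStarOf, ScrewPinch.DynProfile.zetaStar]
  rw [div_pow _ (r ^ 2 * Real.sqrt (hlK.Bsq r) * hlK.hlDGP 1 (-1 / 5) (-(13 / 1000) ^ 2) r),
    mul_pow (r ^ 2 * Real.sqrt (hlK.Bsq r)) (hlK.hlDGP 1 (-1 / 5) (-(13 / 1000) ^ 2) r),
    mul_pow (r ^ 2) (Real.sqrt (hlK.Bsq r)), hs, hlDGP_eqK013 hr0, deriv_xiK013]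
  simp only [ScrewPinch.DynProfile.kPerpB, ScrewPinch.Profile.kDotB, bsq_eqK, xiK013, XIP_eval013, dXIP_eval013]
  simp only [hlK, uK, pK]
  have h2 : (49 : ℝ) + 102 * r ^ 2 + 49 * r ^ 4 ≠ 0 := by positivity
  field_simp
  simp only [ZNL013, Poly.eval_cons, Poly.eval_nil]
  push_cast
  ring

/-- The norm density of `(ξ, η_*, ζ_*)` as a function continuous on `[0, 1]`. [instance data] -/
def kinK013 (r : ℝ) : ℝ :=
  hlK.ρ r * (xiK013 r ^ 2 + Poly.eval ENL013 r ^ 2 / (hlK.Bsq r * (hlDnum013 r * (1 + r ^ 2)) ^ 2)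
    + Poly.eval ZNL013 r ^ 2 / (hlK.Bsq r * (hlDnum013 r * (1 + r ^ 2)) ^ 2)) * r

/-- On `(0, 1]` the norm density IS `kinK013`. [instance data] -/
theorem kineticDensity_eqK013 {r : ℝ} (hr : 0 < r) (hr1 : r ≤ 1) :
    hlK.kineticDensity xiK013 (hlK.etaStarOf 1 (-1 / 5) (13 / 1000) xiK013) (hlK.zetaStarOf 1 (-1 / 5) (13 / 1000) xiK013) r = kinK013 r := by
  simp only [ScrewPinch.DynProfile.kineticDensity, kinK013]
  rw [etaStar_sqK013 hr hr1, zetaStar_sqK013 hr hr1]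

/-- `H` is continuous. [instance data] -/
theorem continuous_hlDnum013 : Continuous hlDnum013 := by
  unfold hlDnum013; fun_prop

/-- `kinK013` is continuous on `[0, 1]`. [instance data] -/
theorem continuousOn_kinK013 : ContinuousOn kinK013 (Icc (0 : ℝ) 1) := by
  have hden : ∀ r ∈ Icc (0 : ℝ) 1, hlK.Bsq r * (hlDnum013 r * (1 + r ^ 2)) ^ 2 ≠ 0 := by
    intro r hr
    have := bsq_posK r
    have := hlDnum_pos013 hr.1 hr.2
    positivity
  have hρ : hlK.ρ = fun _ => (1 : ℝ) := rfl
  unfold kinK013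
  rw [hρ]
  have cx : Continuous xiK013 := by unfold xiK013; exact Polynomial.continuous _
  have c1 : ContinuousOn (fun r => Poly.eval ENL013 r ^ 2 / (hlK.Bsq r * (hlDnum013 r * (1 + r ^ 2)) ^ 2)) (Icc (0:ℝ) 1) :=
    ((Poly.continuous_eval ENL013).pow 2).continuousOn.div
      ((continuous_bsqK.mul ((continuous_hlDnum013.mul (by fun_prop)).pow 2)).continuousOn) hden
  have c2 : ContinuousOn (fun r => Poly.eval ZNL013 r ^ 2 / (hlK.Bsq r * (hlDnum013 r * (1 + r ^ 2)) ^ 2)) (Icc (0:ℝ) 1) :=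
    ((Poly.continuous_eval ZNL013).pow 2).continuousOn.div
      ((continuous_bsqK.mul ((continuous_hlDnum013.mul (by fun_prop)).pow 2)).continuousOn) hden
  exact (continuousOn_const.mul (((cx.pow 2).continuousOn.add c1).add c2)).mul continuousOn_id

/-- The reduced density as a function continuous on `[0, 1]`. [instance data] -/
def redK013 (r : ℝ) : ℝ := Poly.eval RNL013 r / (hlDnum013 r * (1 + r ^ 2) ^ 3 * (25 + r ^ 2) ^ 2)

/-- `redK013` is continuous on `[0, 1]`. [instance data] -/
theorem continuousOn_redK013 : ContinuousOn redK013 (Icc (0 : ℝ) 1) := by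
  unfold redK013
  refine (Poly.continuous_eval RNL013).continuousOn.div ((continuous_hlDnum013.mul (by fun_prop)).mul (by fun_prop)).continuousOn ?_
  intro r hr
  have := hlDnum_pos013 hr.1 hr.2
  positivity

/-- The norm density of `(ξ, η_*, ζ_*)` is integrable on `[0, 1]`. [instance data] -/
theorem kineticDensity_integrableK013 :
    IntervalIntegrable (hlK.kineticDensity xiK013 (hlK.etaStarOf 1 (-1 / 5) (13 / 1000) xiK013) (hlK.zetaStarOf 1 (-1 / 5) (13 / 1000) xiK013))
      volume 0 1 := by
  rw [intervalIntegrable_iff_integrableOn_Ioc_of_le zero_le_one]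
  have hK : IntegrableOn kinK013 (Ioc (0 : ℝ) 1) volume :=
    (continuousOn_kinK013.integrableOn_Icc).mono_set Ioc_subset_Icc_self
  exact hK.congr_fun (fun r hr => (kineticDensity_eqK013 hr.1 hr.2).symm) measurableSet_Ioc

/-- The reduced density is integrable on `[0, 1]`. [instance data] -/
theorem reducedDensity_integrableK013 :
    IntervalIntegrable (hlK.reducedDensity 1 (-1 / 5) (13 / 1000) xiK013) volume 0 1 := by
  rw [intervalIntegrable_iff_integrableOn_Ioc_of_le zero_le_one]
  have hR : IntegrableOn redK013 (Ioc (0 : ℝ) 1) volume :=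
    (continuousOn_redK013.integrableOn_Icc).mono_set Ioc_subset_Icc_self
  exact hR.congr_fun (fun r hr => by rw [redK013, reducedDensity_eqK013 hr.1 hr.2]) measurableSet_Ioc

/-- On `(0, 1]` the energy density of `(ξ, η_*, ζ_*)` is `𝓡_ξ − σ²·(norm density)` (§10 `density_star_eq_reduced`). [instance data] -/
theorem potentialDensity_eqK013 {r : ℝ} (hr : 0 < r) (hr1 : r ≤ 1) :
    hlK.potentialDensity 1 (-1 / 5) xiK013 (hlK.etaStarOf 1 (-1 / 5) (13 / 1000) xiK013) (hlK.zetaStarOf 1 (-1 / 5) (13 / 1000) xiK013) r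
      = redK013 r - (13 / 1000) ^ 2 * kinK013 r := by
  have h := ScrewPinch.DynProfile.density_star_eq_reduced (P := hlK) (m := 1) (k := -1 / 5) (σ := 13 / 1000) hr
    (Or.inl one_ne_zero) (by norm_num) (by show (0 : ℝ) < 1; norm_num) (by show (0 : ℝ) ≤ 5 / 3; norm_num)
    (by show (0 : ℝ) < 1; norm_num) (pK_pos hr.le (by linarith)).le (bsq_posK r) xiK013
  rw [kineticDensity_eqK013 hr hr1, reducedDensity_eqK013 hr hr1] at h
  rw [redK013]
  linarith

/-- The energy density of `(ξ, η_*, ζ_*)` is integrable on `[0, 1]`. [instance data] -/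
theorem potentialDensity_integrableK013 :
    IntervalIntegrable (hlK.potentialDensity 1 (-1 / 5) xiK013 (hlK.etaStarOf 1 (-1 / 5) (13 / 1000) xiK013)
      (hlK.zetaStarOf 1 (-1 / 5) (13 / 1000) xiK013)) volume 0 1 := by
  rw [intervalIntegrable_iff_integrableOn_Ioc_of_le zero_le_one]
  have h : IntegrableOn (fun r => redK013 r - (13 / 1000) ^ 2 * kinK013 r) (Ioc (0 : ℝ) 1) volume :=
    ((continuousOn_redK013.sub (continuousOn_const.mul continuousOn_kinK013)).integrableOn_Icc).mono_set Ioc_subset_Icc_self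
  exact h.congr_fun (fun r hr => (potentialDensity_eqK013 hr.1 hr.2).symm) measurableSet_Ioc

/-! ### §5 The witness inequality and the theorems -/

/-- **`∫₀¹ 𝓡_ξ dr < 0`** (`≤ ∫₀¹ U = -1.0508e-05 ≈ −1.05·10⁻⁵`; own float value of the integral itself −1.751·10⁻⁵). [instance data] -/
theorem integral_reducedDensity_negK013 : ∫ r in (0 : ℝ)..1, hlK.reducedDensity 1 (-1 / 5) (13 / 1000) xiK013 r < 0 := by
  have hR := reducedDensity_integrableK013
  have hU : IntervalIntegrable (fun r => Poly.eval UL013 r) volume 0 1 := (Poly.continuous_eval UL013).intervalIntegrable _ _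
  have hle : ∫ r in (0 : ℝ)..1, hlK.reducedDensity 1 (-1 / 5) (13 / 1000) xiK013 r ≤ ∫ r in (0 : ℝ)..1, Poly.eval UL013 r := by
    rw [intervalIntegral.integral_of_le zero_le_one, intervalIntegral.integral_of_le zero_le_one]
    refine setIntegral_mono_on ?_ ?_ measurableSet_Ioc (fun r hr => reducedDensity_le_U013 hr.1 hr.2)
    · exact (intervalIntegrable_iff_integrableOn_Ioc_of_le zero_le_one).mp hR
    · exact (intervalIntegrable_iff_integrableOn_Ioc_of_le zero_le_one).mp hU
  exact lt_of_le_of_lt hle integral_UL_neg013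

/-- **#95 «F3.σ-KINK-UNSTABLE»** (CERTIFIED, MODEL M_kink, CLASS C): the displacement `(ξ, η_*, ζ_*)` — lit-4's explicit degree-24
`ξ` with `ξ(1) = 0` and the §10 algebraic minimisers — of the Fourier mode `(m, k) = (1, −1/5)` has `W + σ²I < 0` at `σ = 13/1000`:
MODEL M_kink (lit-4's `KinkEqQ07.hlK`: force-balanced screw pinch with `q = (7/10)(1 + r²)`, `q = 1` inside at `r² = 3/7`, `R₀ = 5a`,
wall at the plasma) is NOT σ-stable at `σ = 0.013 v_A/a`.  MODELLED spectral reading (GoedbloedPoedts2004 (6.117), §9.4.1 Theorem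
p. 470): an ideal internal-kink perturbation growing at least at `0.013 v_A/a` — a WITNESS, not an eigenmode; `q₀ = 7/10` is a SYNTHETIC
model choice; never «the plasma is unstable»; not about any device. [instance data] -/
theorem kink_sigma_unstable013 :
    hlK.sigmaModifiedEnergy 1 (-1 / 5) (13 / 1000) 1 xiK013 (hlK.etaStarOf 1 (-1 / 5) (13 / 1000) xiK013)
      (hlK.zetaStarOf 1 (-1 / 5) (13 / 1000) xiK013) < 0 :=
  ScrewPinch.DynProfile.sigmaModifiedEnergy_star_neg_of_integral_neg (P := hlK) (m := 1) (k := -1 / 5) (σ := 13 / 1000) (a := 1)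
    one_pos (Or.inl one_ne_zero) (by norm_num) (by show (0 : ℝ) < 1; norm_num) (by show (0 : ℝ) ≤ 5 / 3; norm_num)
    (fun r _ => by show (0 : ℝ) < 1; norm_num) (fun r hr => (pK_pos hr.1.le (by linarith [hr.2])).le) (fun r _ => bsq_posK r)
    potentialDensity_integrableK013 kineticDensity_integrableK013 integral_reducedDensity_negK013

/-- Hence NO σ-stability certificate at `σ = 13/1000` can exist for MODEL M_kink's `(1,1)` mode with this `ξ`: not every `(η, ζ)` gives
`W + σ²I > 0`. [instance data] -/
theorem kink_not_sigmaStable013 :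
    ¬ (∀ η ζ : ℝ → ℝ, 0 < hlK.sigmaModifiedEnergy 1 (-1 / 5) (13 / 1000) 1 xiK013 η ζ) :=
  ScrewPinch.DynProfile.not_sigmaStable_of_witness (P := hlK) (m := 1) (k := -1 / 5) (σ := 13 / 1000) (a := 1)
    one_pos (Or.inl one_ne_zero) (by norm_num) (by show (0 : ℝ) < 1; norm_num) (by show (0 : ℝ) ≤ 5 / 3; norm_num)
    (fun r _ => by show (0 : ℝ) < 1; norm_num) (fun r hr => (pK_pos hr.1.le (by linarith [hr.2])).le) (fun r _ => bsq_posK r)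
    potentialDensity_integrableK013 kineticDensity_integrableK013 integral_reducedDensity_negK013

/-- **The ideal ENERGY PRINCIPLE is VIOLATED on MODEL M_kink:** the witness displacement has `W < 0` (`W < −σ²I ≤ 0`). [instance data] -/
theorem kink_potentialEnergy_neg013 :
    hlK.potentialEnergy 1 (-1 / 5) 1 xiK013 (hlK.etaStarOf 1 (-1 / 5) (13 / 1000) xiK013) (hlK.zetaStarOf 1 (-1 / 5) (13 / 1000) xiK013) < 0 := by
  have h := kink_sigma_unstable013
  have hI := kineticNorm_nonnegK xiK013 (hlK.etaStarOf 1 (-1 / 5) (13 / 1000) xiK013) (hlK.zetaStarOf 1 (-1 / 5) (13 / 1000) xiK013)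
  unfold ScrewPinch.DynProfile.sigmaModifiedEnergy at h
  nlinarith

end Summit.Ventures.FusionMHD.Models.KinkEqQ07

end
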